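/-
L62 «TWO-PRIME FOLD RIGIDITY» — support S `IntegerScrew.ZetaOffLineReduction` (item stmt-RiemannHypothesis-25787; planner
rh-idea-10 g2; filer rh-split-typer-3 g6 on lead g12 RULING #499 (c)).  RH-free bookkeeping over tree facts: Suzuki2023
Thm 1.1 (2) (`Suzuki2023_thm11_series_holds`), the symmetries `ρ ↦ ρ̄`, `ρ ↦ 1 - ρ̄` of the non-trivial zeros and of
their multiplicities, `|Im ρ| > 14`, `Σ m/γ² < ∞`, finiteness of zero boxes.  Nothing here bears on the truth of RH.
-/
import Summits.RiemannHypothesis.RiemannHypothesis.Theorems.Splittings.ScrewLatticeFozB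
import Literature.NumberTheory.LFunctions.ZetaScrewSeriesProofs
import Literature.NumberTheory.LFunctions.ZetaScrewGrowthMomentsProofs
import Literature.NumberTheory.LFunctions.SekatskiiGeneralizedBombieriLagarias
import Literature.NumberTheory.LFunctions.ZetaZerosReflection
import HarnessLib

/-!
# `ZetaOffLineReduction` (route `IntegerScrew`, LINE L62 «TWO-PRIME FOLD RIGIDITY», support S)

ζ's off-line zeros `ρ` with `Re ρ > 1/2`, `Im ρ > 0`, packaged as `κ = ρ - 1/2` with multiplicity `m = ord_ρ ζ`,
form a configuration of K1's class — `m > 0`, `0 < Re κ < 1/2`, `Im κ > 1` (indeed `> 14`), locally finite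
ordinates, `Σ m/γ² < ∞` — which is EMPTY only if RH holds (reflection `ρ ↦ 1 - ρ̄` and conjugation), and whose
model fold `k ↦ Σ 4 m Re[(cosh(κ k h) - 1)/κ²]` on ANY lattice `hℕ⁺` is bounded as soon as `Ψ = zetaScrew` is:
by Suzuki's series `Ψ(t) = Σ_ρ m_ρ (cosh((ρ-½)t) - 1)/(ρ-½)²` the on-line zeros contribute a real number in
`[-C₀, C₀]`, `C₀ = Σ_ρ 2m_ρ/γ_ρ²`, and the off-line zeros come in quadruples `{ρ, ρ̄, 1-ρ̄, 1-ρ}` with equal real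
contributions, so the upper-right quarter carries exactly `(Ψ(t) - on-line part)/4`.

Main result: `zetaOffLineReduction_unfolded`, whose type is the item's signature VERBATIM (the route decl
`Summit.RiemannHypothesis.RiemannHypothesis.Theses.IntegerScrew.ZetaOffLineReduction` is not yet rendered in
`Theses/IntegerScrew.lean`; the by-name closer is a one-line `exact` once it is).  RH-free; std axioms.
-/

noncomputable section

set_option linter.dupNamespace false

open Complex
open scoped ComplexConjugate

namespace Summit.RiemannHypothesis.RiemannHypothesis.Theorems.TwoPrimeFoldZetaOffLineReduction

open Literature.NumberTheory.LFunctions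
open Literature.NumberTheory.LFunctions.ZetaZeros (riemannZetaNontrivialZeros)
open Summit.RiemannHypothesis.RiemannHypothesis.Theorems.Splittings

/-! ## 1. The terms of Suzuki's series and their symmetries -/

/-- Real part of the term of Suzuki's series at a zero: `Re[m (cosh(κ t) - 1)/κ²] = m · Re[(cosh(κt) - 1)/κ²]`,
`κ = ρ - 1/2` (the multiplicity is an integer). -/
theorem re_term_eq (ρ : ℂ) (t : ℝ) :
    ((riemannZetaZeroOrder ρ : ℂ) * ((Complex.cosh ((ρ - 1 / 2) * t) - 1) / (ρ - 1 / 2) ^ 2)).re =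
      (riemannZetaZeroOrder ρ : ℝ) * ((Complex.cosh ((ρ - 1 / 2) * t) - 1) / (ρ - 1 / 2) ^ 2).re := by
  rw [show (riemannZetaZeroOrder ρ : ℂ) = ((riemannZetaZeroOrder ρ : ℝ) : ℂ) by norm_cast,
    Complex.re_ofReal_mul]

/-- Conjugation symmetry of the terms: `Re T(ρ̄, t) = Re T(ρ, t)` (`m(ρ̄) = m(ρ)`, `cosh` commutes with `conj`). -/
theorem re_term_conj (ρ : ℂ) (t : ℝ) :
    ((riemannZetaZeroOrder (conj ρ) : ℂ) *
        ((Complex.cosh ((conj ρ - 1 / 2) * t) - 1) / (conj ρ - 1 / 2) ^ 2)).re =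
      ((riemannZetaZeroOrder ρ : ℂ) * ((Complex.cosh ((ρ - 1 / 2) * t) - 1) / (ρ - 1 / 2) ^ 2)).re := by
  rw [riemannZetaZeroOrder_conj_holds ρ]
  have hc : conj (ρ - 1 / 2) = conj ρ - 1 / 2 := by
    rw [map_sub, map_div₀, map_one, map_ofNat]
  have h : (riemannZetaZeroOrder ρ : ℂ) * ((Complex.cosh ((conj ρ - 1 / 2) * t) - 1) / (conj ρ - 1 / 2) ^ 2) =
      conj ((riemannZetaZeroOrder ρ : ℂ) * ((Complex.cosh ((ρ - 1 / 2) * t) - 1) / (ρ - 1 / 2) ^ 2)) := by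
    rw [map_mul, map_intCast, map_div₀, map_pow, hc, map_sub (starRingEnd ℂ) (Complex.cosh _) 1, map_one,
      ← Complex.cosh_conj, map_mul, Complex.conj_ofReal, hc]
  rw [h, Complex.conj_re]

/-- Reflection symmetry of the terms in the strip: `Re T(1 - ρ̄, t) = Re T(ρ, t)` for `0 < Re ρ < 1`
(`m(1 - ρ̄) = m(ρ)`, `cosh` even). -/
theorem re_term_one_sub_conj {ρ : ℂ} (h₀ : 0 < ρ.re) (h₁ : ρ.re < 1) (t : ℝ) :
    ((riemannZetaZeroOrder (1 - conj ρ) : ℂ) *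
        ((Complex.cosh ((1 - conj ρ - 1 / 2) * t) - 1) / (1 - conj ρ - 1 / 2) ^ 2)).re =
      ((riemannZetaZeroOrder ρ : ℂ) * ((Complex.cosh ((ρ - 1 / 2) * t) - 1) / (ρ - 1 / 2) ^ 2)).re := by
  rw [riemannZetaZeroOrder_one_sub_conj h₀ h₁]
  have hc : (1 : ℂ) - conj ρ - 1 / 2 = -(conj ρ - 1 / 2) := by ring
  rw [hc, neg_sq, neg_mul, Complex.cosh_neg]
  have h := re_term_conj ρ t
  rwa [riemannZetaZeroOrder_conj_holds ρ] at h

/-! ## 2. The verbatim statement of the item -/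

/-- **`ZetaOffLineReduction` (item stmt-RiemannHypothesis-25787 of route `IntegerScrew`, LINE L62 support S), stated
VERBATIM as filed.**  Witness: `ι` = the non-trivial zeros `ρ` of `ζ` with `Re ρ > 1/2` and `Im ρ > 0`, `m = ord_ρ ζ`,
`κ = ρ - 1/2`.  (i) `m > 0`; (ii) `0 < Re κ < 1/2`; (iii) `Im κ > 14 > 1`; (iv) ordinates locally finite
(`zetaZeroBox_finite`); (v) `Σ m/γ² < ∞` (`ZetaScrewGrowth.summable_two_mul_order_div_im_sq`); (vi) `ι` empty ⇒ every
non-trivial zero has `Re ρ ≤ 1/2` (else `ρ` or `ρ̄` would lie in `ι`) ⇒ RH (`Sekatskii.riemannHypothesis_iff_forall_re_le_half`);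
(vii) for `t = k h`: Suzuki's series (`Suzuki2023_thm11_series_holds`) splits as on-line part (real, `|·| ≤ Σ 2m/γ²`
termwise by `ScrewLatticeFoz.norm_term_le`) plus the off-line part, which by the symmetries `ρ ↦ ρ̄` (lower ↔ upper
half) and `ρ ↦ 1 - ρ̄` (left ↔ right of the line) is `4 ×` the sum over `ι`; hence the fold over `ι` is bounded by
`A + Σ 2m/γ²` whenever `|Ψ(k h)| ≤ A`.  RH-free. -/
theorem zetaOffLineReduction_unfolded :
    ∃ (ι : Type) (m : ι → ℝ) (κ : ι → ℂ), (∀ i, 0 < m i) ∧ (∀ i, 0 < (κ i).re ∧ (κ i).re < 1 / 2) ∧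
      (∀ i, 1 < (κ i).im) ∧ (∀ T : ℝ, {i | (κ i).im ≤ T}.Finite) ∧ Summable (fun i ↦ m i / (κ i).im ^ 2) ∧
      (IsEmpty ι → _root_.RiemannHypothesis) ∧
      ∀ h : ℝ, 0 < h → (∃ A : ℝ, ∀ k : ℕ, 1 ≤ k → |Literature.NumberTheory.LFunctions.zetaScrew ((k : ℝ) * h)| ≤ A) →
        (∃ A : ℝ, ∀ k : ℕ, 1 ≤ k →
          |∑' i, 4 * m i * ((Complex.cosh (κ i * (((k : ℝ) * h : ℝ) : ℂ)) - 1) / κ i ^ 2).re| ≤ A) := by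
  classical
  -- the index set: upper-right off-line zeros, as a subset of the non-trivial zeros
  set U : Set riemannZetaNontrivialZeros := {ρ | 1 / 2 < (ρ : ℂ).re ∧ 0 < (ρ : ℂ).im} with hU
  refine ⟨U, fun i ↦ (riemannZetaZeroOrder ((i : riemannZetaNontrivialZeros) : ℂ) : ℝ),
    fun i ↦ ((i : riemannZetaNontrivialZeros) : ℂ) - 1 / 2, ?_, ?_, ?_, ?_, ?_, ?_, ?_⟩
  · -- (i) multiplicities are positive
    intro i
    exact FordL33.order_pos i.1
  · -- (ii) `0 < Re κ < 1/2`
    intro i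
    have h1 := i.2.1
    have h2 := ZetaZeros.riemannZetaNontrivialZeros.re_lt_one i.1.2
    simp only [sub_re, one_div, Complex.inv_re, Complex.re_ofNat, Complex.normSq_ofNat]
    constructor <;> nlinarith
  · -- (iii) `Im κ > 1`
    intro i
    have h14 := FordL33.fourteen_lt_abs_im i.1
    have hpos := i.2.2
    rw [abs_of_pos hpos] at h14
    simp only [sub_im, one_div, Complex.inv_im, Complex.im_ofNat, neg_zero, zero_div, sub_zero]
    linarith
  · -- (iv) local finiteness of the ordinates
    intro T
    have hfin := zetaZeroBox_finite (1 / 2) T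
    have hinj : Set.InjOn (fun i : U ↦ ((i : riemannZetaNontrivialZeros) : ℂ))
        ((fun i : U ↦ ((i : riemannZetaNontrivialZeros) : ℂ)) ⁻¹' zetaZeroBox (1 / 2) T) :=
      (Subtype.val_injective.comp Subtype.val_injective).injOn
    refine (hfin.preimage hinj).subset fun i hi ↦ ?_
    simp only [Set.mem_setOf_eq, sub_im, one_div, Complex.inv_im, Complex.im_ofNat, neg_zero, zero_div,
      sub_zero] at hi
    simp only [Set.mem_preimage, zetaZeroBox, Set.mem_setOf_eq]
    exact ⟨ZetaZeros.riemannZetaNontrivialZeros.zeta_eq_zero i.1.2, i.2.1.le,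
      (ZetaZeros.riemannZetaNontrivialZeros.re_lt_one i.1.2).le, i.2.2, hi⟩
  · -- (v) `Σ m/γ² < ∞`
    have hS := (ZetaScrewGrowth.summable_two_mul_order_div_im_sq).subtype (· ∈ U)
    refine Summable.of_nonneg_of_le (fun i ↦ ?_) (fun i ↦ ?_) hS
    · have := FordL33.order_pos i.1
      positivity
    · have hm := FordL33.order_pos i.1
      simp only [Function.comp_apply, sub_im, one_div, Complex.inv_im, Complex.im_ofNat, neg_zero, zero_div,
        sub_zero]
      have hγ : 0 < ((i : riemannZetaNontrivialZeros) : ℂ).im ^ 2 := by have := i.2.2; positivity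
      rw [div_le_div_iff_of_pos_right hγ]
      linarith
  · -- (vi) emptiness forces RH
    intro hE
    rw [Sekatskii.riemannHypothesis_iff_forall_re_le_half]
    intro ρ
    refine le_of_not_gt fun hlt ↦ ?_
    rcases lt_or_gt_of_ne (ZetaZeros.riemannZetaNontrivialZeros.im_ne_zero ρ.2) with him | him
    · refine hE.false ⟨⟨conj (ρ : ℂ), ZetaZeros.riemannZetaNontrivialZeros.conj_mem ρ.2⟩, ?_⟩
      simp only [hU, Set.mem_setOf_eq, Complex.conj_re, Complex.conj_im]
      exact ⟨hlt, by linarith⟩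
    · exact hE.false ⟨ρ, hlt, him⟩
  · -- (vii) transfer of lattice boundedness
    intro h hh hA
    obtain ⟨A, hA⟩ := hA
    -- `C₀ = Σ 2m/γ²`
    set b : riemannZetaNontrivialZeros → ℝ := fun ρ ↦ 2 * (riemannZetaZeroOrder (ρ : ℂ) : ℝ) / (ρ : ℂ).im ^ 2
      with hb
    have hbs : Summable b := ZetaScrewGrowth.summable_two_mul_order_div_im_sq
    have hb0 : ∀ ρ, 0 ≤ b ρ := fun ρ ↦ by
      have := FordL33.order_pos ρ
      simp only [hb]; positivity
    refine ⟨A + ∑' ρ, b ρ, fun k hk ↦ ?_⟩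
    set t : ℝ := (k : ℝ) * h with ht
    have ht0 : 0 ≤ t := by positivity
    -- Suzuki's series at `t`, real parts
    set F : riemannZetaNontrivialZeros → ℂ := fun ρ ↦ (riemannZetaZeroOrder (ρ : ℂ) : ℂ) *
      ((Complex.cosh (((ρ : ℂ) - 1 / 2) * t) - 1) / ((ρ : ℂ) - 1 / 2) ^ 2) with hF
    set G : riemannZetaNontrivialZeros → ℝ := fun ρ ↦ (F ρ).re with hG
    have hHas : HasSum F (zetaScrew t : ℂ) := Suzuki2023_thm11_series_holds t
    have hGsum : HasSum G (zetaScrew t) := by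
      have := Complex.hasSum_re hHas
      simpa [hG] using this
    have hGs : Summable G := hGsum.summable
    -- termwise bound `|G ρ| ≤ e^{|σ| t} b ρ`, and on the line `|G ρ| ≤ b ρ`
    have hGle : ∀ ρ : riemannZetaNontrivialZeros, (ρ : ℂ).re = 1 / 2 → ‖G ρ‖ ≤ b ρ := fun ρ hρ ↦ by
      have h1 := ScrewLatticeFoz.norm_term_le ρ ht0
      rw [hρ, sub_self, abs_zero, zero_mul, Real.exp_zero, one_mul] at h1
      exact (Real.norm_eq_abs _ ▸ Complex.abs_re_le_norm (F ρ)).trans h1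
    -- the four relevant subsets of the non-trivial zeros
    set L : Set riemannZetaNontrivialZeros := {ρ | (ρ : ℂ).re = 1 / 2} with hL
    set P : Set riemannZetaNontrivialZeros := {ρ | (ρ : ℂ).re ≠ 1 / 2 ∧ 0 < (ρ : ℂ).im} with hP
    set N : Set riemannZetaNontrivialZeros := {ρ | (ρ : ℂ).re ≠ 1 / 2 ∧ (ρ : ℂ).im < 0} with hN
    set U₃ : Set riemannZetaNontrivialZeros := {ρ | (ρ : ℂ).re < 1 / 2 ∧ 0 < (ρ : ℂ).im} with hU₃
    have hLc : Lᶜ = P ∪ N := by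
      ext ρ
      simp only [hL, hP, hN, Set.mem_compl_iff, Set.mem_setOf_eq, Set.mem_union]
      constructor
      · intro hne
        rcases lt_or_gt_of_ne (ZetaZeros.riemannZetaNontrivialZeros.im_ne_zero ρ.2) with him | him
        · exact Or.inr ⟨hne, him⟩
        · exact Or.inl ⟨hne, him⟩
      · rintro (⟨hne, -⟩ | ⟨hne, -⟩) <;> exact hne
    have hPU : P = U ∪ U₃ := by
      ext ρ
      simp only [hP, hU, hU₃, Set.mem_setOf_eq, Set.mem_union]
      constructor
      · rintro ⟨hne, him⟩
        rcases lt_or_gt_of_ne hne with hlt | hgt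
        · exact Or.inr ⟨hlt, him⟩
        · exact Or.inl ⟨hgt, him⟩
      · rintro (⟨hgt, him⟩ | ⟨hlt, him⟩)
        · exact ⟨hgt.ne', him⟩
        · exact ⟨hlt.ne, him⟩
    have hdPN : Disjoint P N := by
      rw [Set.disjoint_left]
      rintro ρ ⟨-, h1⟩ ⟨-, h2⟩
      linarith
    have hdU : Disjoint U U₃ := by
      rw [Set.disjoint_left]
      rintro ρ ⟨h1, -⟩ ⟨h2, -⟩
      linarith
    -- splitting the series
    have hsplit₁ : (∑' ρ : L, G ρ) + ∑' ρ : (Lᶜ : Set riemannZetaNontrivialZeros), G ρ = zetaScrew t := by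
      rw [hGs.tsum_subtype_add_tsum_subtype_compl L, hGsum.tsum_eq]
    have hsplit₂ : (∑' ρ : (Lᶜ : Set riemannZetaNontrivialZeros), G ρ) = (∑' ρ : P, G ρ) + ∑' ρ : N, G ρ := by
      rw [tsum_congr_set_coe G hLc]
      exact Summable.tsum_union_disjoint hdPN (hGs.subtype _) (hGs.subtype _)
    have hsplit₃ : (∑' ρ : P, G ρ) = (∑' ρ : U, G ρ) + ∑' ρ : U₃, G ρ := by
      rw [tsum_congr_set_coe G hPU]
      exact Summable.tsum_union_disjoint hdU (hGs.subtype _) (hGs.subtype _)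
    -- conjugation: `N ≃ P`, preserving `G`
    have hNP : (∑' ρ : N, G ρ) = ∑' ρ : P, G ρ := by
      let e : P ≃ N :=
        { toFun := fun ρ ↦ ⟨⟨conj ((ρ : riemannZetaNontrivialZeros) : ℂ),
              ZetaZeros.riemannZetaNontrivialZeros.conj_mem ρ.1.2⟩, by
            have h1 := ρ.2.1; have h2 := ρ.2.2
            simp only [hN, Set.mem_setOf_eq, Complex.conj_re, Complex.conj_im]
            exact ⟨h1, by linarith⟩⟩
          invFun := fun ρ ↦ ⟨⟨conj ((ρ : riemannZetaNontrivialZeros) : ℂ),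
              ZetaZeros.riemannZetaNontrivialZeros.conj_mem ρ.1.2⟩, by
            have h1 := ρ.2.1; have h2 := ρ.2.2
            simp only [hP, Set.mem_setOf_eq, Complex.conj_re, Complex.conj_im]
            exact ⟨h1, by linarith⟩⟩
          left_inv := fun ρ ↦ by ext; simp
          right_inv := fun ρ ↦ by ext; simp }
      rw [← Equiv.tsum_eq e]
      refine tsum_congr fun ρ ↦ ?_
      simp only [hG, hF, e, Equiv.coe_fn_mk]
      exact re_term_conj _ t
    -- reflection: `U₃ ≃ U`, preserving `G`
    have hU₃U : (∑' ρ : U₃, G ρ) = ∑' ρ : U, G ρ := by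
      let e : U ≃ U₃ :=
        { toFun := fun ρ ↦ ⟨⟨1 - conj ((ρ : riemannZetaNontrivialZeros) : ℂ),
              ZetaZeros.riemannZetaNontrivialZeros.one_sub_conj_mem ρ.1.2⟩, by
            have h1 := ρ.2.1; have h2 := ρ.2.2
            simp only [hU₃, Set.mem_setOf_eq, sub_re, one_re, Complex.conj_re, sub_im, one_im,
              Complex.conj_im]
            exact ⟨by linarith, by linarith⟩⟩
          invFun := fun ρ ↦ ⟨⟨1 - conj ((ρ : riemannZetaNontrivialZeros) : ℂ),
              ZetaZeros.riemannZetaNontrivialZeros.one_sub_conj_mem ρ.1.2⟩, by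
            have h1 := ρ.2.1; have h2 := ρ.2.2
            simp only [hU, Set.mem_setOf_eq, sub_re, one_re, Complex.conj_re, sub_im, one_im,
              Complex.conj_im]
            exact ⟨by linarith, by linarith⟩⟩
          left_inv := fun ρ ↦ by ext; simp
          right_inv := fun ρ ↦ by ext; simp }
      rw [← Equiv.tsum_eq e]
      refine tsum_congr fun ρ ↦ ?_
      simp only [hG, hF, e, Equiv.coe_fn_mk]
      exact re_term_one_sub_conj (ZetaZeros.riemannZetaNontrivialZeros.re_pos ρ.1.2)
        (ZetaZeros.riemannZetaNontrivialZeros.re_lt_one ρ.1.2) t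
    -- the on-line part is bounded by `C₀`
    have hLb : |∑' ρ : L, G ρ| ≤ ∑' ρ, b ρ := by
      have h1 : ‖∑' ρ : L, G ρ‖ ≤ ∑' ρ : L, b ρ :=
        tsum_of_norm_bounded ((hbs.subtype _).hasSum) fun ρ ↦ hGle ρ ρ.2
      rw [Real.norm_eq_abs] at h1
      exact h1.trans (hbs.tsum_subtype_le b L hb0)
    -- assembling: `4 Σ_U G = Ψ(t) - Σ_L G`
    have hkey : 4 * ∑' ρ : U, G ρ = zetaScrew t - ∑' ρ : L, G ρ := by
      rw [← hsplit₁, hsplit₂, hNP, hsplit₃, hU₃U]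
      ring
    -- the target series is `4 Σ_U G`
    have htarget : (∑' i : U, 4 * (riemannZetaZeroOrder ((i : riemannZetaNontrivialZeros) : ℂ) : ℝ) *
        ((Complex.cosh ((((i : riemannZetaNontrivialZeros) : ℂ) - 1 / 2) * (((k : ℝ) * h : ℝ) : ℂ)) - 1) /
          (((i : riemannZetaNontrivialZeros) : ℂ) - 1 / 2) ^ 2).re) = 4 * ∑' ρ : U, G ρ := by
      rw [← tsum_mul_left]
      refine tsum_congr fun i ↦ ?_
      simp only [hG, hF, re_term_eq, ht]
      ring
    rw [htarget, hkey]
    have h1 := hA k hk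
    exact (abs_sub _ _).trans (add_le_add h1 hLb)

end Summit.RiemannHypothesis.RiemannHypothesis.Theorems.TwoPrimeFoldZetaOffLineReduction

end
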